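import Summits.MatrixMultiplication.OmegaCensus.STPPVosperInversePairLaw

/-!
# ω-census (abelian STPP census): three inverse-pair Vosper-table kills at `ℤ₆₁` (kernel)

HONEST FRAMING (pub-omega census; verbatim): lottery ticket; floor = certified bounds/negative ranges.
Census STRUCTURE (seat pub-omega-stpp-1 gen 29, 2026-08-28), family (b2).  Applications of `no_isSTPP_of_inverse_pair_tables` (`STPPVosperInversePairLaw.lean`) to
the three 4-block minimal beating patterns of `ℤ₆₁` (enumeration HOME `pub-omega-stpp-1-g29/scan/vosper_scan2_61_nb4.json`: 1 125 939 classes, 50 alive under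
the python N7–N20) that survive every single table but die by a pair of mutually inverse readings: `{(1,1,2),(2,3,2),(3,2,4),(3,2,4)}` (pair `(A,B)`,
tables `(42,18,2)` / `(43,19,3)`), `{(1,1,2),(2,3,2),(4,3,2),(4,3,2)}` (pair `(A,C)` via the family `(−A,−C,−B)`, tables `(41,17,2)` / `(44,20,4)`),
`{(1,1,2),(3,3,2),(3,3,2),(3,4,2)}` (pair `(B,C)` via the family `(B,C,A)`, same tables).  All four tables have survivors `{0, 1, 60, 30, 31}`
(`31 ≡ −30`), and `30·30, 30·31, 31·31 ≢ ±1 (mod 61)` is the side condition.  Nothing here is progress on `ω`.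

References: A. G. Vosper, J. London Math. Soc. 31 (1956); M. B. Nathanson, *Additive Number Theory: Inverse Problems*, GTM 165, Thm 2.7; H. Cohn,
R. Kleinberg, B. Szegedy, C. Umans, FOCS 2005 (arXiv:math/0511460), Def. 5.1.
-/

open Finset
open scoped Pointwise

namespace Summit.MatrixMultiplication.OmegaCensus.CubeNB

open Literature.Computability.AlgebraicComplexity
open Literature.Combinatorics.Additive
open Summit.MatrixMultiplication.OmegaCensus.STPPKneser

/-! ## Tables and the side condition -/

/-- Table `(42, 18, 2)`: survivors `{0, 1, 60, 30, 31}`. [folklore] -/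
theorem table_42_18_2 : ∀ j < 61, ∀ t < 61, (∀ i < 18, (t + j * i) % 61 < 42) →
    (∀ k < 18, 2 ∣ (t + j * k) % 61 - #((range 18).filter fun i => (t + j * i) % 61 < (t + j * k) % 61)) →
    j ∈ ({0, 1, 60, 30, 31} : Finset ℕ) := by
  decide +kernel

/-- Table `(43, 19, 3)`: survivors `{0, 1, 60, 30, 31}`. [folklore] -/
theorem table_43_19_3 : ∀ j < 61, ∀ t < 61, (∀ i < 19, (t + j * i) % 61 < 43) →
    (∀ k < 19, 3 ∣ (t + j * k) % 61 - #((range 19).filter fun i => (t + j * i) % 61 < (t + j * k) % 61)) →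
    j ∈ ({0, 1, 60, 30, 31} : Finset ℕ) := by
  decide +kernel

/-- Table `(41, 17, 2)`: survivors `{0, 1, 60, 30, 31}`. [folklore] -/
theorem table_41_17_2 : ∀ j < 61, ∀ t < 61, (∀ i < 17, (t + j * i) % 61 < 41) →
    (∀ k < 17, 2 ∣ (t + j * k) % 61 - #((range 17).filter fun i => (t + j * i) % 61 < (t + j * k) % 61)) →
    j ∈ ({0, 1, 60, 30, 31} : Finset ℕ) := by
  decide +kernel

/-- Table `(44, 20, 4)`: survivors `{0, 1, 60, 30, 31}`. [folklore] -/
theorem table_44_20_4 : ∀ j < 61, ∀ t < 61, (∀ i < 20, (t + j * i) % 61 < 44) →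
    (∀ k < 20, 4 ∣ (t + j * k) % 61 - #((range 20).filter fun i => (t + j * i) % 61 < (t + j * k) % 61)) →
    j ∈ ({0, 1, 60, 30, 31} : Finset ℕ) := by
  decide +kernel

/-- The side condition for two tables with survivors `{0, 1, 60, 30, 31}`: a product `d₁d₂ ≡ ±1 (mod 61)` forces `d₁ = ±1`. [folklore] -/
theorem side_3031 : ∀ d₁ ∈ ({0, 1, 60, 30, 31} : Finset ℕ), ∀ d₂ ∈ ({0, 1, 60, 30, 31} : Finset ℕ),
    (d₁ * d₂ % 61 = 1 ∨ d₁ * d₂ % 61 = 60) → (d₁ = 1 ∨ d₁ = 60) := by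
  decide

/-! ## Kills -/

/-- **`{(1,1,2),(2,3,2),(3,2,4),(3,2,4)}` has no STPP family in `ℤ₆₁`** (inverse-pair law on `(A₃, B₃)` at a `(3,2,4)` block: `(z,b,vol,a,L) =
(18,2,24,3,16)`, tables `(42,18,2)` and `(43,19,3)`). [cite: CohnKleinbergSzegedyUmans2005, Def. 5.1] [cite: Nathanson1996, Thm 2.7] -/
theorem no_isSTPP_zmod61_112_232_324_324 (A B C : Fin 4 → Finset (ZMod 61)) (hS : IsSTPP A B C)
    (hA : ∀ i, #(A i) = ![1, 2, 3, 3] i) (hB : ∀ i, #(B i) = ![1, 3, 2, 2] i) (hC : ∀ i, #(C i) = ![2, 2, 4, 4] i) : False := by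
  have hAne : ∀ i, (A i).Nonempty := fun i => card_pos.1 (by rw [hA]; fin_cases i <;> simp)
  have hBne : ∀ i, (B i).Nonempty := fun i => card_pos.1 (by rw [hB]; fin_cases i <;> simp)
  have hCne : ∀ i, (C i).Nonempty := fun i => card_pos.1 (by rw [hC]; fin_cases i <;> simp)
  have e2 : (univ : Finset (Fin 4)).erase 2 = {0, 1, 3} := by decide
  have hz : ∑ k ∈ (univ : Finset (Fin 4)).erase 2, #(A k) * #(C k) = 18 := by
    rw [e2, Finset.sum_insert (by decide), Finset.sum_pair (by decide)]; simp [hA, hC]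
  have hL : ∑ k ∈ (univ : Finset (Fin 4)).erase 2, #(B k) * #(C k) = 16 := by
    rw [e2, Finset.sum_insert (by decide), Finset.sum_pair (by decide)]; simp [hB, hC]
  exact no_isSTPP_of_inverse_pair_tables A B C hS hAne hBne hCne 2 ⟨0, by decide⟩ (by rw [hA]; simp) (by rw [hB]; simp) (by rw [hC]; simp)
    (show 3 * 2 * 4 = 24 from rfl) hz hL (by norm_num) (by norm_num) (by norm_num) (by norm_num) (by norm_num) (by norm_num)
    (m := 18) (n := 42) (m'' := 19) (n'' := 43) rfl rfl rfl rfl table_42_18_2 table_43_19_3 side_3031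

/-- **`{(1,1,2),(2,3,2),(4,3,2),(4,3,2)}` has no STPP family in `ℤ₆₁`** (inverse-pair law on `(A₃, C₃)`: the family `(−A, −C, −B)` at a `(4,2,3)` block,
`(z,b,vol,a,L) = (19,2,24,4,14)`, tables `(41,17,2)` and `(44,20,4)`). [cite: CohnKleinbergSzegedyUmans2005, Def. 5.1] [cite: Nathanson1996, Thm 2.7] -/
theorem no_isSTPP_zmod61_112_232_432_432 (A B C : Fin 4 → Finset (ZMod 61)) (hS : IsSTPP A B C)
    (hA : ∀ i, #(A i) = ![1, 2, 4, 4] i) (hB : ∀ i, #(B i) = ![1, 3, 3, 3] i) (hC : ∀ i, #(C i) = ![2, 2, 2, 2] i) : False := by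
  have hAne : ∀ i, (A i).Nonempty := fun i => card_pos.1 (by rw [hA]; fin_cases i <;> simp)
  have hBne : ∀ i, (B i).Nonempty := fun i => card_pos.1 (by rw [hB]; fin_cases i <;> simp)
  have hCne : ∀ i, (C i).Nonempty := fun i => card_pos.1 (by rw [hC]; fin_cases i <;> simp)
  set A' : Fin 4 → Finset (ZMod 61) := fun t => (A t).image Neg.neg with hA'
  set B' : Fin 4 → Finset (ZMod 61) := fun t => (C t).image Neg.neg with hB'
  set C' : Fin 4 → Finset (ZMod 61) := fun t => (B t).image Neg.neg with hC'
  have hS' : IsSTPP A' B' C' := STPP222SqNeg.isSTPP_negSwap hS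
  have hcA' : ∀ t, #(A' t) = #(A t) := fun t => Finset.card_image_of_injective _ neg_injective
  have hcB' : ∀ t, #(B' t) = #(C t) := fun t => Finset.card_image_of_injective _ neg_injective
  have hcC' : ∀ t, #(C' t) = #(B t) := fun t => Finset.card_image_of_injective _ neg_injective
  have e2 : (univ : Finset (Fin 4)).erase 2 = {0, 1, 3} := by decide
  have hz : ∑ k ∈ (univ : Finset (Fin 4)).erase 2, #(A' k) * #(C' k) = 19 := by
    rw [e2, Finset.sum_insert (by decide), Finset.sum_pair (by decide)]; simp [hcA', hcC', hA, hB]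
  have hL : ∑ k ∈ (univ : Finset (Fin 4)).erase 2, #(B' k) * #(C' k) = 14 := by
    rw [e2, Finset.sum_insert (by decide), Finset.sum_pair (by decide)]; simp [hcB', hcC', hB, hC]
  have ha : #(A' 2) = 4 := by rw [hcA', hA]; simp
  have hb : #(B' 2) = 2 := by rw [hcB', hC]; simp
  have hc : #(C' 2) = 3 := by rw [hcC', hB]; simp
  exact no_isSTPP_of_inverse_pair_tables A' B' C' hS' (fun t => (hAne t).image _) (fun t => (hCne t).image _)
    (fun t => (hBne t).image _) 2 ⟨0, by decide⟩ ha hb hc (show 4 * 2 * 3 = 24 from rfl) hz hL (by norm_num) (by norm_num) (by norm_num)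
    (by norm_num) (by norm_num) (by norm_num) (m := 17) (n := 41) (m'' := 20) (n'' := 44) rfl rfl rfl rfl table_41_17_2 table_44_20_4 side_3031

/-- **`{(1,1,2),(3,3,2),(3,3,2),(3,4,2)}` has no STPP family in `ℤ₆₁`** (inverse-pair law on `(B₄, C₄)`: the rotated family `(B, C, A)` at the `(3,4,2)` block,
read as `(4,2,3)`; `(z,b,vol,a,L) = (19,2,24,4,14)`, tables `(41,17,2)` and `(44,20,4)`). [cite: CohnKleinbergSzegedyUmans2005, Def. 5.1]
[cite: Nathanson1996, Thm 2.7] -/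
theorem no_isSTPP_zmod61_112_332_332_342 (A B C : Fin 4 → Finset (ZMod 61)) (hS : IsSTPP A B C)
    (hA : ∀ i, #(A i) = ![1, 3, 3, 3] i) (hB : ∀ i, #(B i) = ![1, 3, 3, 4] i) (hC : ∀ i, #(C i) = ![2, 2, 2, 2] i) : False := by
  have hAne : ∀ i, (A i).Nonempty := fun i => card_pos.1 (by rw [hA]; fin_cases i <;> simp)
  have hBne : ∀ i, (B i).Nonempty := fun i => card_pos.1 (by rw [hB]; fin_cases i <;> simp)
  have hCne : ∀ i, (C i).Nonempty := fun i => card_pos.1 (by rw [hC]; fin_cases i <;> simp)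
  have hS' : IsSTPP B C A := stpp_rotate hS
  have e3 : (univ : Finset (Fin 4)).erase 3 = {0, 1, 2} := by decide
  have hz : ∑ k ∈ (univ : Finset (Fin 4)).erase 3, #(B k) * #(A k) = 19 := by
    rw [e3, Finset.sum_insert (by decide), Finset.sum_pair (by decide)]; simp [hA, hB]
  have hL : ∑ k ∈ (univ : Finset (Fin 4)).erase 3, #(C k) * #(A k) = 14 := by
    rw [e3, Finset.sum_insert (by decide), Finset.sum_pair (by decide)]; simp [hA, hC]
  exact no_isSTPP_of_inverse_pair_tables B C A hS' hBne hCne hAne 3 ⟨0, by decide⟩ (by rw [hB]; simp) (by rw [hC]; simp) (by rw [hA]; simp)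
    (show 4 * 2 * 3 = 24 from rfl) hz hL (by norm_num) (by norm_num) (by norm_num) (by norm_num) (by norm_num) (by norm_num)
    (m := 17) (n := 41) (m'' := 20) (n'' := 44) rfl rfl rfl rfl table_41_17_2 table_44_20_4 side_3031

end Summit.MatrixMultiplication.OmegaCensus.CubeNB
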